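import Summits.NavierStokesRegularity.NavierStokesRegularity.Theses.HubbleDynamo
import Summits.NavierStokesRegularity.NavierStokesRegularity.Theses.TypeICertificateLadder
import Summits.NavierStokesRegularity.NavierStokesRegularity.Theorems.TypeILiouvilleLKillsTypeI
import Summits.NavierStokesRegularity.NavierStokesRegularity.Theorems.HubbleDynamoDynamoKillsTypeI
import HarnessLib

/-!
# Route HubbleDynamo — crux `FarFieldSlaving` (stmt-NavierStokesRegularity-1935): its position
  relative to `NoTypeIBlowup` (stmt-1217) and the KNSS Liouville conjecture (L) (stmt-10661)

Support file (theorems only, `--supports stmt-NavierStokesRegularity-1935`) recording where the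
crux `FarFieldSlaving` ("Type I in time ⇒ every point is a space–time Type-I centre") sits in the
web of items of the sub-problem:

* `hubbleDynamo_farFieldSlaving_of_typeIExtends` — the crux is implied by the Type-I EXTENSION
  statement "a Leray–Hopf classical solution from a rapidly decaying datum with the Type-I rate
  extends smoothly past `T`" (verbatim the crux `TypeICertificateLadder.NoTypeIBlowup`,
  stmt-NavierStokesRegularity-1217, shared by seven routes): an extension is continuous on the
  compact cylinders `[0, T] × B̄₁(x₀)`, hence bounded by some `M` below `(x₀, T)`, and a local bound
  is a space–time Type-I bound with constant `|M| · 2r` (the crux is only non-trivial AT a Type-I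
  singularity). By name: `hubbleDynamo_farFieldSlaving_of_noTypeIBlowup`.
* `hubbleDynamo_farFieldSlaving_of_liouvilleConjectureNS` — hence the crux is implied by the KNSS
  Liouville conjecture (L) (`Literature.Analysis.FluidPDE.LiouvilleConjectureNS` = item
  `TypeILiouville.TypeIliouvilleL`, stmt-NavierStokesRegularity-10661), through the tree's
  `typeIExtends_of_liouvilleConjectureNS` ((L) kills Type-I blow-up).
* `hubbleDynamo_noTypeIBlowup_of_cruxes`, `hubbleDynamo_farFieldSlaving_iff_noTypeIBlowup` —
  conversely the route's own proved glue `DynamoKillsTypeI` (stmt-1936) gives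
  `NoSelfExcitedDynamo → FarFieldSlaving → NoTypeIBlowup`, so MODULO the route's first crux
  `NoSelfExcitedDynamo` the second crux `FarFieldSlaving` is EQUIVALENT to `NoTypeIBlowup`.

Consequences for the line `registered` of the crux (lead's census): the two open stubs
`stub_isolatedSingularPoints` and `stub_vorticityDilution` are each implied by `NoTypeIBlowup`
(an extension past `T` bounds `u` and `curl u` near `(x₀, T)`), i.e. they are crux-sized, not
lemma-sized; no printed theorem gives either under the sup-norm rate alone.
-/

noncomputable section

-- the problem directory repeats the summit name (D-0017); core's `dupNamespace` linter fires on
-- every declaration of `Summit.NavierStokesRegularity.NavierStokesRegularity.…` (same in all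
-- sibling Theorems files)
set_option linter.dupNamespace false

namespace Summit.NavierStokesRegularity.NavierStokesRegularity.Theorems

open Set Filter Topology Function MeasureTheory Metric
open Literature.Analysis Literature.Analysis.FluidPDE
open Summit.NavierStokesRegularity.NavierStokesRegularity.Theses

/-- **A smooth extension past `T` is bounded below `(x, T)`.** If the velocity `u` agrees on
`[0, T)`, `T > 0`, with a classical solution on some `[0, T')`, `T' > T`
(`HasSmoothExtensionPast ν 0 u T`), then for every `x` it is bounded on the parabolic cylinder
`B_r(x) × (T − r², T)` with `r = min 1 √T` (so that `T − r² ≥ 0` and no unconstrained negative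
time is used): the extension is jointly continuous on `[0, T') × ℝ³ ⊇ [0, T] × B̄₁(x)`, a compact
set. [folklore] -/
theorem hubbleDynamo_locallyBounded_of_hasSmoothExtensionPast {ν T : ℝ} (hT : 0 < T)
    {u : ℝ → EuclideanSpace ℝ (Fin 3) → EuclideanSpace ℝ (Fin 3)}
    (hext : HasSmoothExtensionPast ν 0 u T) (x : EuclideanSpace ℝ (Fin 3)) :
    ∃ r : ℝ, 0 < r ∧ ∃ M : ℝ, ∀ t ∈ Set.Ioo (T - r ^ 2) T, ∀ y ∈ Metric.ball x r,
      ‖u t y‖ ≤ M := by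
  obtain ⟨T', hTT', u', p', hcl', hagree⟩ := hext
  -- the extension is continuous on the compact cylinder `[0, T] × closedBall x 1`
  have hcont : ContinuousOn (uncurry u') (Ico 0 T' ×ˢ univ) := hcl'.smooth_velocity.continuousOn
  have hK : IsCompact (Icc 0 T ×ˢ closedBall x 1) := isCompact_Icc.prod (isCompact_closedBall x 1)
  have hKsub : Icc 0 T ×ˢ closedBall x 1 ⊆ Ico 0 T' ×ˢ (univ : Set (EuclideanSpace ℝ (Fin 3))) :=
    prod_mono (fun t ht => ⟨ht.1, lt_of_le_of_lt ht.2 hTT'⟩) (subset_univ _)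
  obtain ⟨M, hM⟩ := hK.exists_bound_of_continuousOn (hcont.mono hKsub)
  -- the radius `r = min 1 √T`
  set r : ℝ := min 1 (Real.sqrt T) with hr_def
  have hr1 : r ≤ 1 := min_le_left _ _
  have hrpos : 0 < r := lt_min one_pos (Real.sqrt_pos.2 hT)
  have hr2 : r ^ 2 ≤ T := by
    have h1 : r * r ≤ Real.sqrt T * Real.sqrt T :=
      mul_le_mul (min_le_right _ _) (min_le_right _ _) hrpos.le (Real.sqrt_nonneg _)
    rw [Real.mul_self_sqrt hT.le] at h1
    simpa [sq] using h1
  refine ⟨r, hrpos, M, fun t ht y hy => ?_⟩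
  have ht0 : 0 ≤ t := by linarith [ht.1]
  have hty : (t, y) ∈ Icc 0 T ×ˢ closedBall x 1 :=
    ⟨⟨ht0, ht.2.le⟩, mem_closedBall.2 ((mem_ball.1 hy).le.trans hr1)⟩
  have h := hM (t, y) hty
  rw [uncurry_apply_pair, hagree t ⟨ht0, ht.2⟩] at h
  exact h

/-- **The Type-I extension statement implies the crux `FarFieldSlaving`.** If every Leray–Hopf
classical solution from a rapidly decaying datum with the Type-I rate extends smoothly past `T`
(the statement of `TypeICertificateLadder.NoTypeIBlowup`, stmt-NavierStokesRegularity-1217,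
taken verbatim as the hypothesis), then every point `x₀` is a space–time Type-I centre: the
extension bounds `u` by some `M` on a cylinder `B_r(x₀) × (T − r², T)`
(`hubbleDynamo_locallyBounded_of_hasSmoothExtensionPast`), where `‖x − x₀‖ + √(T − t) < 2r`, so
`‖u t x‖ ≤ M ≤ |M| · 2r / (‖x − x₀‖ + √(T − t))`. [folklore] -/
theorem hubbleDynamo_farFieldSlaving_of_typeIExtends
    (h : ∀ (ν T : ℝ), 0 < ν → 0 < T →
      ∀ (u : ℝ → EuclideanSpace ℝ (Fin 3) → EuclideanSpace ℝ (Fin 3))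
        (p : ℝ → EuclideanSpace ℝ (Fin 3) → ℝ),
        IsClassicalNSSolutionOn (Set.Ico 0 T) ν 0 u p → IsLerayHopfOn T ν 0 (u 0) u →
        HasRapidSpatialDecay (u 0) → IsTypeIBlowup u T → HasSmoothExtensionPast ν 0 u T) :
    Summit.NavierStokesRegularity.NavierStokesRegularity.Theses.HubbleDynamo.FarFieldSlaving := by
  intro ν T hν hT u p hcl hLH hdec hTI x₀
  have hext : HasSmoothExtensionPast ν 0 u T := h ν T hν hT u p hcl hLH hdec hTI
  obtain ⟨r, hr, M, hM⟩ := hubbleDynamo_locallyBounded_of_hasSmoothExtensionPast hT hext x₀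
  refine ⟨r, hr, |M| * (2 * r), fun t ht x hx => ?_⟩
  have hTt : 0 < T - t := sub_pos.2 ht.2
  have hsqrt_pos : 0 < Real.sqrt (T - t) := Real.sqrt_pos.2 hTt
  have hsqrt_lt : Real.sqrt (T - t) < r := by
    have h1 : T - t < r ^ 2 := by linarith [ht.1]
    calc Real.sqrt (T - t) < Real.sqrt (r ^ 2) := Real.sqrt_lt_sqrt hTt.le h1
      _ = r := Real.sqrt_sq hr.le
  have hxlt : ‖x - x₀‖ < r := by rwa [← dist_eq_norm, ← mem_ball]
  have hdpos : 0 < ‖x - x₀‖ + Real.sqrt (T - t) :=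
    add_pos_of_nonneg_of_pos (norm_nonneg _) hsqrt_pos
  have hdlt : ‖x - x₀‖ + Real.sqrt (T - t) ≤ 2 * r := by linarith
  calc ‖u t x‖ ≤ M := hM t ht x hx
    _ ≤ |M| := le_abs_self M
    _ ≤ |M| * (2 * r) / (‖x - x₀‖ + Real.sqrt (T - t)) := by
        rw [le_div_iff₀ hdpos]
        exact mul_le_mul_of_nonneg_left hdlt (abs_nonneg M)

/-- **`NoTypeIBlowup` (stmt-NavierStokesRegularity-1217) implies `FarFieldSlaving`
(stmt-NavierStokesRegularity-1935)**, by name: the crux of route HubbleDynamo is a consequence of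
the Type-I extension crux shared by TypeICertificateLadder and six other routes. [folklore] -/
theorem hubbleDynamo_farFieldSlaving_of_noTypeIBlowup :
    Summit.NavierStokesRegularity.NavierStokesRegularity.Theses.TypeICertificateLadder.NoTypeIBlowup →
      Summit.NavierStokesRegularity.NavierStokesRegularity.Theses.HubbleDynamo.FarFieldSlaving :=
  fun h => hubbleDynamo_farFieldSlaving_of_typeIExtends h

/-- **(L) implies `FarFieldSlaving`** — CONDITIONAL on the KNSS Liouville conjecture
`Literature.Analysis.FluidPDE.LiouvilleConjectureNS` (open; = item `TypeILiouville.TypeIliouvilleL`,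
stmt-NavierStokesRegularity-10661): (L) kills Type-I blow-up in the Clay class
(`typeIExtends_of_liouvilleConjectureNS`), and the extension gives the crux
(`hubbleDynamo_farFieldSlaving_of_typeIExtends`). [cite: KochNadirashviliSereginSverak2009, §1 conjecture (L) and §6 Prop. 6.1 (arXiv:0709.3599)] -/
theorem hubbleDynamo_farFieldSlaving_of_liouvilleConjectureNS
    (hL : Literature.Analysis.FluidPDE.LiouvilleConjectureNS) :
    Summit.NavierStokesRegularity.NavierStokesRegularity.Theses.HubbleDynamo.FarFieldSlaving :=
  hubbleDynamo_farFieldSlaving_of_typeIExtends (typeIExtends_of_liouvilleConjectureNS hL)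

/-- **(L) as the route item `TypeIliouvilleL` (stmt-NavierStokesRegularity-10661) implies
`FarFieldSlaving`**, by name (the item is definitionally `LiouvilleConjectureNS`). [cite: KochNadirashviliSereginSverak2009, §1 conjecture (L) (arXiv:0709.3599)] -/
theorem hubbleDynamo_farFieldSlaving_of_typeIliouvilleL
    (hL : Summit.NavierStokesRegularity.NavierStokesRegularity.Theses.TypeILiouville.TypeIliouvilleL) :
    Summit.NavierStokesRegularity.NavierStokesRegularity.Theses.HubbleDynamo.FarFieldSlaving :=
  hubbleDynamo_farFieldSlaving_of_typeIExtends (typeIExtends_of_liouvilleConjectureNS hL)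

/-- **The two cruxes of HubbleDynamo give `NoTypeIBlowup`** (stmt-NavierStokesRegularity-1217), by
the route's proved zoom glue `DynamoKillsTypeI` (stmt-NavierStokesRegularity-1936,
`hubbleDynamo_dynamoKillsTypeI_proof`), whose conclusion is `NoTypeIBlowup` verbatim. [cite: KochNadirashviliSereginSverak2009, §6 proof of Thm 6.2 (arXiv:0709.3599 pp. 11–13)] -/
theorem hubbleDynamo_noTypeIBlowup_of_cruxes
    (h₁ : Summit.NavierStokesRegularity.NavierStokesRegularity.Theses.HubbleDynamo.NoSelfExcitedDynamo)
    (h₂ : Summit.NavierStokesRegularity.NavierStokesRegularity.Theses.HubbleDynamo.FarFieldSlaving) :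
    Summit.NavierStokesRegularity.NavierStokesRegularity.Theses.TypeICertificateLadder.NoTypeIBlowup :=
  hubbleDynamo_dynamoKillsTypeI_proof h₁ h₂

/-- **Modulo `NoSelfExcitedDynamo`, the crux `FarFieldSlaving` is EQUIVALENT to `NoTypeIBlowup`.**
Given the first crux of route HubbleDynamo (the pointwise-class Liouville theorem, stmt-1934),
its second crux `FarFieldSlaving` (stmt-1935) holds iff the Type-I extension statement
`NoTypeIBlowup` (stmt-1217) holds: `→` is the route's zoom glue, `←` is
`hubbleDynamo_farFieldSlaving_of_noTypeIBlowup`. So, as a price for working in the pointwise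
class, `FarFieldSlaving` is not cheaper than the conclusion it serves unless it is proved by a
mechanism that does not pass through the extension. [folklore] -/
theorem hubbleDynamo_farFieldSlaving_iff_noTypeIBlowup
    (h₁ : Summit.NavierStokesRegularity.NavierStokesRegularity.Theses.HubbleDynamo.NoSelfExcitedDynamo) :
    Summit.NavierStokesRegularity.NavierStokesRegularity.Theses.HubbleDynamo.FarFieldSlaving ↔
      Summit.NavierStokesRegularity.NavierStokesRegularity.Theses.TypeICertificateLadder.NoTypeIBlowup :=
  ⟨fun h₂ => hubbleDynamo_noTypeIBlowup_of_cruxes h₁ h₂, hubbleDynamo_farFieldSlaving_of_noTypeIBlowup⟩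

/-! ## The chain of EXISTING items above the crux (lead c2, 2026-08-17)

`SqueezeLiouville` (stmt-11608) ⟹ `NoSingularTypeIModel` (stmt-10569) ⟹ `NoTypeIBlowup`
(stmt-1217) ⟹ `FarFieldSlaving` (stmt-1935): the middle arrow is the PROVED shared item
`ClockStretchingLaw.SingularZoom` (stmt-10573, `clockStretchingLaw_singularZoom_proof`), so the
weakest recorded open item known to imply the crux is `NoSingularTypeIModel` ("no smooth
divergence-free KNSS-mild ancient solution with the Type-I rate and Type-I scaled energies is
singular at the origin"). -/

/-- **`NoSingularTypeIModel` (stmt-NavierStokesRegularity-10569) ⟹ `FarFieldSlaving`**, through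
the PROVED shared item `ClockStretchingLaw.SingularZoom` (stmt-10573: no singular Type-I model ⟹
Type-I extension; Albritton–Barker 2019 §3 forward zoom + KNSS 2009 Lemma 6.1) and
`hubbleDynamo_farFieldSlaving_of_typeIExtends`. CONDITIONAL on the open item; it does not close
the crux. [cite: AlbrittonBarker2019, §3 (arXiv:1811.00502)] -/
theorem hubbleDynamo_farFieldSlaving_of_noSingularTypeIModel :
    Summit.NavierStokesRegularity.NavierStokesRegularity.Theses.ClockStretchingLaw.NoSingularTypeIModel →
      Summit.NavierStokesRegularity.NavierStokesRegularity.Theses.HubbleDynamo.FarFieldSlaving :=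
  fun hX => hubbleDynamo_farFieldSlaving_of_typeIExtends (clockStretchingLaw_singularZoom_proof hX)

/-- **Liouville on the Type-I model class kills its singular elements** (the two lines of logic
between `SqueezeCycle.SqueezeLiouville`, stmt-11608, and the antecedent of `SingularZoom`): a field
vanishing identically on `t < 0` is not unbounded in the parabolic cylinders at the origin.
[folklore] -/
theorem hubbleDynamo_noSingularTypeIModel_of_squeezeLiouville
    (hL : Summit.NavierStokesRegularity.NavierStokesRegularity.Theses.SqueezeCycle.SqueezeLiouville) :
    Summit.NavierStokesRegularity.NavierStokesRegularity.Theses.ClockStretchingLaw.NoSingularTypeIModel := by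
  intro C v hv hsing
  obtain ⟨t, ht, x, -, hlt⟩ := hsing 1 one_pos 0
  have h0 : v t x = 0 := hL C v hv t ht.2 x
  rw [h0, norm_zero] at hlt
  exact lt_irrefl _ hlt

/-- **`SqueezeLiouville` (stmt-NavierStokesRegularity-11608) ⟹ `FarFieldSlaving`** (Liouville on
the Type-I model class `𝒦_C` — strictly between (L) and `NoSingularTypeIModel` — gives the crux).
CONDITIONAL on the open item. [cite: KochNadirashviliSereginSverak2009, §6 Prop. 6.1 (arXiv:0709.3599)] -/
theorem hubbleDynamo_farFieldSlaving_of_squeezeLiouville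
    (hL : Summit.NavierStokesRegularity.NavierStokesRegularity.Theses.SqueezeCycle.SqueezeLiouville) :
    Summit.NavierStokesRegularity.NavierStokesRegularity.Theses.HubbleDynamo.FarFieldSlaving :=
  hubbleDynamo_farFieldSlaving_of_noSingularTypeIModel
    (hubbleDynamo_noSingularTypeIModel_of_squeezeLiouville hL)

end Summit.NavierStokesRegularity.NavierStokesRegularity.Theorems

end
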